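import Summits.BirchSwinnertonDyer.BirchSwinnertonDyer.Theorems.ClassRecordThreeEulerHalvesAtThreeCartanTransportCoverReduction
import Literature.NumberTheory.Automorphic.BrandtModuleChains
import Literature.NumberTheory.Automorphic.BrandtModuleProofs
import HarnessLib

/-!
# Cartan transport, brick X1 — residue maps on over-orders and the hull residue map of a cover reduction

Helper file for the crux `EulerHalvesAtThree` of route `ClassRecordThree` (node served: residue crux `EulerHalvesAtThreeResidualUpperBound`,
line `cartan`, item NUM := `CartanOnePlaceDegreeLawAtThree`, skeleton `Lines/lattice` v2, mixed input (P+T)). Lane (α′): the split sheet of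
the cover is a presentation of level `(D, Mq²; C∖q)`. This first brick is residue algebra only:
* §1 `mem_of_smul_mem` — **`q`-saturation**: if `O₀ ≤ O₂` are `ℤ`-orders and `O₀` has a matrix residue map mod `q`, then
  `y ∈ O₂`, `q y ∈ O₀` force `y ∈ O₀` (the residues `ψ(q N)`, `N = {n ∈ O₂ : q n ∈ O₀}`, form a two-sided ideal of `M₂(𝔽_q)`; if it
  contained `1` then `1/q ∈ O₂`, contradicting `[O₂ : O₀] < ∞`); hence some `m'` prime to `q` has `m' O₂ ⊆ O₀`
  (`exists_smul_mem_not_dvd`);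
* §2 `exists_residueMap_of_le` — the residue map extends to `O₂`: `ψ₂ y := m'⁻¹ ψ(m' y)` is a matrix residue map mod `q` on `O₂`
  agreeing with `ψ` on `O₀`;
* §3 `exists_residueMap_of_coverReduction` — for `R : CoverReduction X q` the map `x ↦ n_q⁻¹ R.red (n_q x)` is a matrix residue map
  mod `q` on the hull `X.O₀` extending `R.red` (`n_q = ∏_{C∖q} p`).
No definition is introduced; nothing is proved about NUM, (F2b♮) or any summit statement.
[cite: Voight2021, Lemma 23.2.3, Def. 23.4.1, 23.4.3] [cite: VignerasLNM800, Ch. II §2 Thm. 2.3]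
-/

set_option linter.dupNamespace false
set_option autoImplicit false

open scoped MatrixGroups

namespace Summit.BirchSwinnertonDyer.BirchSwinnertonDyer.Theorems.CartanTransport.Split

open Literature.NumberTheory.Automorphic
open Summit.BirchSwinnertonDyer.BirchSwinnertonDyer.Theorems.CartanTransport
open Summit.BirchSwinnertonDyer.BirchSwinnertonDyer.Theorems.CartanCover

/-! ## §0 Two small matrix ∕ arithmetic facts -/

/-- PROVED — `E₀₀ + E₁₁ = 1` in `M₂`. -/
theorem single_zero_add_single_one {F : Type*} [Semiring F] :
    Matrix.single (0 : Fin 2) (0 : Fin 2) (1 : F) + Matrix.single 1 1 1 = 1 := by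
  ext i j
  fin_cases i <;> fin_cases j <;> simp [Matrix.single]

/-- PROVED — Bezout for an integer prime to the prime `q`. -/
theorem exists_bezout_of_not_dvd {q n : ℕ} (hq : q.Prime) (hn : ¬ q ∣ n) : ∃ a b : ℤ, a * n + b * q = 1 := by
  have hcop : Nat.Coprime n q := Nat.Coprime.symm ((Nat.Prime.coprime_iff_not_dvd hq).mpr hn)
  obtain ⟨a, b, h⟩ := Nat.isCoprime_iff_coprime.mpr hcop
  exact ⟨a, b, h⟩

section Generic

variable {B : Type*} [Ring B] [Algebra ℚ B] {O₀ O₂ : Submodule ℤ B} {q : ℕ} [Fact q.Prime]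
  {ψ : B → Matrix (Fin 2) (Fin 2) (ZMod q)}

/-- PROVED — cancellation of a non-zero integer scalar in a `ℚ`-algebra. -/
theorem zsmul_right_cancel {n : ℤ} (hn : n ≠ 0) {x y : B} (h : n • x = n • y) : x = y := by
  have hq : (n : ℚ) ≠ 0 := by exact_mod_cast hn
  rw [← Int.cast_smul_eq_zsmul ℚ n x, ← Int.cast_smul_eq_zsmul ℚ n y] at h
  simpa [smul_smul, inv_mul_cancel₀ hq] using congrArg ((n : ℚ)⁻¹ • ·) h

omit [Algebra ℚ B] in
/-- PROVED — powers stay in a `ℤ`-order. -/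
theorem pow_mem_of_isZOrder {O : Submodule ℤ B} (h : IsZOrder O) {x : B} (hx : x ∈ O) : ∀ k : ℕ, x ^ k ∈ O
  | 0 => by rw [pow_zero]; exact h.one_mem
  | k + 1 => by rw [pow_succ]; exact h.mul_mem _ (pow_mem_of_isZOrder h hx k) _ hx

/-! ## §1 `q`-saturation of an over-order -/

/-- PROVED — **`q`-saturation.** Let `O₀ ≤ O₂` be `ℤ`-orders of the `ℚ`-algebra `B` and `ψ` a matrix residue map mod `q` on `O₀`.
If `y ∈ O₂` and `q y ∈ O₀` then `y ∈ O₀`: otherwise the two-sided ideal `ψ(q N)` of `M₂(𝔽_q)` (`N = {n ∈ O₂ : q n ∈ O₀}`) contains `1`,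
so `q s = 1` for some `s ∈ O₂`, and then `[O₂ : O₀] s^k ∈ O₀` for all `k` forces `q ∣ [O₂ : O₀] / q^a` for every `a`. [cite: Voight2021, Lemma 23.2.3] -/
theorem mem_of_smul_mem (hψ : IsMatrixResidueMap O₀ q ψ) (h₀ : IsZOrder O₀) (h₂ : IsZOrder O₂) (hle : O₀ ≤ O₂)
    {y : B} (hy : y ∈ O₂) (hqy : ((q : ℕ) : ℤ) • y ∈ O₀) : y ∈ O₀ := by
  classical
  haveI : IsAddTorsionFree B := isAddTorsionFree_of_charZero_module ℚ B
  have hq : q.Prime := Fact.out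
  have hq0 : ((q : ℕ) : ℤ) ≠ 0 := by exact_mod_cast hq.ne_zero
  suffices h0 : ψ (((q : ℕ) : ℤ) • y) = 0 by
    obtain ⟨y₀, hy₀, he⟩ := (hψ.ker _ hqy).mp h0
    have : y = y₀ := zsmul_right_cancel hq0 he
    exact this ▸ hy₀
  by_contra hA
  obtain ⟨i, j, hij⟩ : ∃ i j, ψ (((q : ℕ) : ℤ) • y) i j ≠ 0 := by
    by_contra h
    push Not at h
    exact hA (Matrix.ext h)
  set A := ψ (((q : ℕ) : ℤ) • y) with hAdef
  obtain ⟨a0, ha0, hψa0⟩ := hψ.surj (Matrix.single 0 i (A i j)⁻¹)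
  obtain ⟨a1, ha1, hψa1⟩ := hψ.surj (Matrix.single 1 i (A i j)⁻¹)
  obtain ⟨b0, hb0, hψb0⟩ := hψ.surj (Matrix.single j 0 1)
  obtain ⟨b1, hb1, hψb1⟩ := hψ.surj (Matrix.single j 1 1)
  -- `r := a0 y b0 + a1 y b1 ∈ O₂` has `q r ∈ O₀` and `ψ (q r) = 1`
  have hrO₂ : a0 * y * b0 + a1 * y * b1 ∈ O₂ :=
    add_mem (h₂.mul_mem _ (h₂.mul_mem _ (hle ha0) _ hy) _ (hle hb0)) (h₂.mul_mem _ (h₂.mul_mem _ (hle ha1) _ hy) _ (hle hb1))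
  have hqr : ((q : ℕ) : ℤ) • (a0 * y * b0 + a1 * y * b1) = a0 * (((q : ℕ) : ℤ) • y) * b0 + a1 * (((q : ℕ) : ℤ) • y) * b1 := by
    simp only [smul_add, mul_smul_comm, smul_mul_assoc]
  have h0y : a0 * (((q : ℕ) : ℤ) • y) ∈ O₀ := h₀.mul_mem _ ha0 _ hqy
  have h1y : a1 * (((q : ℕ) : ℤ) • y) ∈ O₀ := h₀.mul_mem _ ha1 _ hqy
  have hqrO₀ : ((q : ℕ) : ℤ) • (a0 * y * b0 + a1 * y * b1) ∈ O₀ := by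
    rw [hqr]
    exact add_mem (h₀.mul_mem _ h0y _ hb0) (h₀.mul_mem _ h1y _ hb1)
  have hψqr : ψ (((q : ℕ) : ℤ) • (a0 * y * b0 + a1 * y * b1)) = 1 := by
    rw [hqr, hψ.map_add _ (h₀.mul_mem _ h0y _ hb0) _ (h₀.mul_mem _ h1y _ hb1), hψ.map_mul _ h0y _ hb0, hψ.map_mul _ ha0 _ hqy,
      hψ.map_mul _ h1y _ hb1, hψ.map_mul _ ha1 _ hqy, hψa0, hψa1, hψb0, hψb1, ← hAdef, Matrix.single_mul_mul_single,
      Matrix.single_mul_mul_single, inv_mul_cancel₀ hij, one_mul, single_zero_add_single_one]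
  -- hence `q s = 1` for some `s ∈ O₂`
  have h1 : ψ (((q : ℕ) : ℤ) • (a0 * y * b0 + a1 * y * b1) - 1) = 0 := by
    rw [hψ.map_sub hqrO₀ h₀.one_mem, hψqr, hψ.map_one, sub_self]
  obtain ⟨y₁, hy₁, he⟩ := (hψ.ker _ (sub_mem hqrO₀ h₀.one_mem)).mp h1
  set s := a0 * y * b0 + a1 * y * b1 - y₁ with hsdef
  have hsO₂ : s ∈ O₂ := sub_mem hrO₂ (hle hy₁)
  have hs : ((q : ℕ) : ℤ) • s = 1 := by
    rw [hsdef, smul_sub, ← he, sub_sub_cancel]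
  have hsk : ∀ k : ℕ, (((q : ℕ) : ℤ) ^ k) • s ^ k = 1 := fun k => by rw [← smul_pow, hs, one_pow]
  -- `[O₂ : O₀] = q ^ a * m'` with `q ∤ m'`; `[O₂ : O₀] s ^ (a+1) ∈ O₀` gives `q ∣ m'`
  have hm0 : O₀.toAddSubgroup.relIndex O₂.toAddSubgroup ≠ 0 :=
    relIndex_ne_zero_of_isFullLattice h₀.isFullLattice h₂.isFullLattice.1
  obtain ⟨a, m', hm', hmeq⟩ := Nat.exists_eq_pow_mul_and_not_dvd hm0 q hq.one_lt.ne'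
  have hx : ((O₀.toAddSubgroup.relIndex O₂.toAddSubgroup : ℕ) : ℤ) • s ^ (a + 1) ∈ O₀ :=
    zsmul_relIndex_mem (pow_mem_of_isZOrder h₂ hsO₂ (a + 1))
  rw [hmeq] at hx
  have hx1 : ((q : ℕ) : ℤ) ^ (a + 1) • ((((q ^ a * m' : ℕ) : ℤ)) • s ^ (a + 1)) = ((q : ℕ) : ℤ) ^ a • ((((m' : ℕ) : ℤ)) • (1 : B)) := by
    rw [smul_comm, hsk, Nat.cast_mul, Nat.cast_pow, mul_smul]
  have hx2 : ((q : ℕ) : ℤ) • ((((q ^ a * m' : ℕ) : ℤ)) • s ^ (a + 1)) = (((m' : ℕ) : ℤ)) • (1 : B) := by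
    apply zsmul_right_cancel (pow_ne_zero a hq0)
    rw [← mul_smul, ← pow_succ, hx1]
  have hψ0 : ψ ((((m' : ℕ) : ℤ)) • (1 : B)) = 0 := by
    rw [← hx2]
    exact hψ.map_smul_eq_zero hx
  rw [hψ.map_zsmul h₀.one_mem, hψ.map_one] at hψ0
  have h00 := congrFun (congrFun hψ0 0) 0
  simp only [Matrix.smul_apply, Matrix.one_apply_eq, zsmul_eq_mul, mul_one, Int.cast_natCast, Matrix.zero_apply] at h00
  rw [ZMod.natCast_eq_zero_iff] at h00
  exact hm' h00

/-- PROVED — some integer `m'` prime to `q` multiplies `O₂` into `O₀` (`[O₂ : O₀] = q^a m'` and `q`-saturation `a` times). -/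
theorem exists_smul_mem_not_dvd (hψ : IsMatrixResidueMap O₀ q ψ) (h₀ : IsZOrder O₀) (h₂ : IsZOrder O₂) (hle : O₀ ≤ O₂) :
    ∃ m' : ℕ, ¬ q ∣ m' ∧ ∀ y ∈ O₂, ((m' : ℕ) : ℤ) • y ∈ O₀ := by
  haveI : IsAddTorsionFree B := isAddTorsionFree_of_charZero_module ℚ B
  have hq : q.Prime := Fact.out
  have hm0 : O₀.toAddSubgroup.relIndex O₂.toAddSubgroup ≠ 0 :=
    relIndex_ne_zero_of_isFullLattice h₀.isFullLattice h₂.isFullLattice.1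
  obtain ⟨a, m', hm', hmeq⟩ := Nat.exists_eq_pow_mul_and_not_dvd hm0 q hq.one_lt.ne'
  refine ⟨m', hm', fun y hy => ?_⟩
  have key : ∀ k : ℕ, ∀ z ∈ O₂, (((q : ℕ) : ℤ) ^ k * ((m' : ℕ) : ℤ)) • z ∈ O₀ → ((m' : ℕ) : ℤ) • z ∈ O₀ := by
    intro k
    induction k with
    | zero => intro z _ h; simpa using h
    | succ k ih =>
      intro z hz h
      apply ih z hz
      apply mem_of_smul_mem hψ h₀ h₂ hle (O₂.smul_mem _ hz)
      rw [← mul_smul, ← mul_assoc, ← pow_succ']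
      exact h
  apply key a y hy
  have := zsmul_relIndex_mem (M := O₀) hy
  rw [hmeq, Nat.cast_mul, Nat.cast_pow] at this
  exact this

/-! ## §2 The residue map extends to an over-order -/

/-- PROVED — **residue map on an over-order.** If `O₀ ≤ O₂` are `ℤ`-orders and `ψ` is a matrix residue map mod `q` on `O₀`, then
`ψ₂ y := m'⁻¹ ψ (m' y)` (`m'` prime to `q` with `m' O₂ ⊆ O₀`) is a matrix residue map mod `q` on `O₂` which agrees with `ψ` on `O₀`
(the completions of `O₀ ⊆ O₂` at `q` coincide). [cite: Voight2021, Lemma 23.2.3, 23.4.3] -/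
theorem exists_residueMap_of_le (hψ : IsMatrixResidueMap O₀ q ψ) (h₀ : IsZOrder O₀) (h₂ : IsZOrder O₂) (hle : O₀ ≤ O₂) :
    ∃ ψ₂ : B → Matrix (Fin 2) (Fin 2) (ZMod q), IsMatrixResidueMap O₂ q ψ₂ ∧ ∀ x ∈ O₀, ψ₂ x = ψ x := by
  classical
  have hq : q.Prime := Fact.out
  obtain ⟨m', hm', hmO⟩ := exists_smul_mem_not_dvd hψ h₀ h₂ hle
  have hc : ((m' : ℕ) : ZMod q) ≠ 0 := by
    rw [Ne, ZMod.natCast_eq_zero_iff]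
    exact hm'
  have hsm : ∀ x ∈ O₀, ψ (((m' : ℕ) : ℤ) • x) = ((m' : ℕ) : ZMod q) • ψ x := fun x hx => by
    rw [hψ.map_zsmul hx, ← Int.cast_smul_eq_zsmul (ZMod q), Int.cast_natCast]
  refine ⟨fun y => ((m' : ℕ) : ZMod q)⁻¹ • ψ (((m' : ℕ) : ℤ) • y), ⟨?_, ?_, ?_, ?_, ?_⟩, ?_⟩
  · intro x hx y hy
    rw [smul_add, hψ.map_add _ (hmO x hx) _ (hmO y hy), smul_add]
  · intro x hx y hy
    have h2 : ψ (((m' : ℕ) : ℤ) • (((m' : ℕ) : ℤ) • (x * y))) = ψ (((m' : ℕ) : ℤ) • x) * ψ (((m' : ℕ) : ℤ) • y) := by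
      rw [← hψ.map_mul _ (hmO x hx) _ (hmO y hy), smul_mul_assoc, mul_smul_comm]
    rw [hsm _ (hmO _ (h₂.mul_mem _ hx _ hy))] at h2
    rw [smul_mul_assoc, mul_smul_comm, smul_smul, ← h2, smul_smul, inv_mul_cancel_right₀ hc]
  · rw [hsm 1 h₀.one_mem, smul_smul, inv_mul_cancel₀ hc, one_smul, hψ.map_one]
  · intro A
    obtain ⟨x, hx, hxA⟩ := hψ.surj A
    exact ⟨x, hle hx, by rw [hsm x hx, smul_smul, inv_mul_cancel₀ hc, one_smul, hxA]⟩
  · intro y hy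
    constructor
    · intro h
      have h' : ψ (((m' : ℕ) : ℤ) • y) = 0 := (smul_eq_zero.mp h).resolve_left (inv_ne_zero hc)
      obtain ⟨y₀, hy₀, he⟩ := (hψ.ker _ (hmO y hy)).mp h'
      obtain ⟨a, b, hab⟩ := exists_bezout_of_not_dvd hq hm'
      refine ⟨a • y₀ + b • y, add_mem (O₂.smul_mem _ (hle hy₀)) (O₂.smul_mem _ hy), ?_⟩
      calc y = (a * ((m' : ℕ) : ℤ) + b * ((q : ℕ) : ℤ)) • y := by rw [hab, one_smul]
        _ = a • (((m' : ℕ) : ℤ) • y) + ((q : ℕ) : ℤ) • (b • y) := by rw [add_smul, mul_smul, mul_comm b, mul_smul]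
        _ = ((q : ℕ) : ℤ) • (a • y₀ + b • y) := by rw [he, smul_add, smul_comm a]
    · rintro ⟨y', hy', rfl⟩
      rw [smul_comm, hψ.map_smul_eq_zero (hmO y' hy'), smul_zero]
  · intro x hx
    show ((m' : ℕ) : ZMod q)⁻¹ • ψ (((m' : ℕ) : ℤ) • x) = ψ x
    rw [hsm x hx, smul_smul, inv_mul_cancel₀ hc, one_smul]

end Generic

/-! ## §3 The hull residue map of a cover reduction -/

section Cover

variable {D M : ℕ} {C : Finset ℕ}

/-- PROVED — **hull residue map of a cover reduction.** For `R : CoverReduction X q` (`q ∈ C`), the map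
`x ↦ n_q⁻¹ R.red (n_q x)` on `X.O₀` (and `0` off it), `n_q = ∏_{C∖q} p`, is a matrix residue map mod `q` on the hull `X.O₀` extending
`R.red` (`n_q X.O₀ ⊆ O₀'` and `n_q` is prime to `q`). [cite: Voight2021, Def. 23.4.1, 23.4.3] -/
theorem exists_residueMap_of_coverReduction (X : CartanLevelCurveData D M C) {q : ℕ} [Fact q.Prime] (hq : q ∈ C)
    (R : CoverReduction X q) :
    ∃ ψ : X.B → Matrix (Fin 2) (Fin 2) (ZMod q), IsMatrixResidueMap X.O₀ q ψ ∧
      ∀ (x : X.B) (hx : x ∈ coverOrder X q), ψ x = R.red ⟨x, hx⟩ := by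
  classical
  have hqP : q.Prime := Fact.out
  have hO₀ : Brandt.IsOrder X.B X.O₀ := X.isEichlerOrder.isOrder
  have hc : ((coverIndex C q : ℕ) : ZMod q) ≠ 0 := Cover.natCast_coverIndex_ne_zero X hq
  have hndvd : ¬ q ∣ coverIndex C q := fun h => hc ((ZMod.natCast_eq_zero_iff _ _).mpr h)
  have hz : ∀ A : Matrix (Fin 2) (Fin 2) (ZMod q), ((coverIndex C q : ℕ) : ℤ) • A = ((coverIndex C q : ℕ) : ZMod q) • A :=
    fun A => by rw [← Int.cast_smul_eq_zsmul (ZMod q), Int.cast_natCast]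
  have hred_smul : ∀ (z : X.B) (hz' : z ∈ coverOrder X q) (hnz : ((coverIndex C q : ℕ) : ℤ) • z ∈ coverOrder X q),
      R.red ⟨((coverIndex C q : ℕ) : ℤ) • z, hnz⟩ = ((coverIndex C q : ℕ) : ZMod q) • R.red ⟨z, hz'⟩ := by
    intro z hz' hnz
    have e : (⟨((coverIndex C q : ℕ) : ℤ) • z, hnz⟩ : coverSubring X q) = ((coverIndex C q : ℕ) : ℤ) • (⟨z, hz'⟩ : coverSubring X q) :=
      rfl
    rw [e, map_zsmul, hz]
  let ψ : X.B → Matrix (Fin 2) (Fin 2) (ZMod q) := fun x =>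
    if hx : x ∈ X.O₀ then ((coverIndex C q : ℕ) : ZMod q)⁻¹ • R.red ⟨((coverIndex C q : ℕ) : ℤ) • x, smul_mem_coverOrder X q hx⟩ else 0
  have hψ : ∀ (x : X.B) (hx : x ∈ X.O₀),
      ψ x = ((coverIndex C q : ℕ) : ZMod q)⁻¹ • R.red ⟨((coverIndex C q : ℕ) : ℤ) • x, smul_mem_coverOrder X q hx⟩ :=
    fun x hx => dif_pos hx
  have hcompat : ∀ (x : X.B) (hx : x ∈ coverOrder X q), ψ x = R.red ⟨x, hx⟩ := fun x hx => by
    rw [hψ x (coverOrder_le X q hx), hred_smul x hx, smul_smul, inv_mul_cancel₀ hc, one_smul]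
  refine ⟨ψ, ⟨?_, ?_, ?_, ?_, ?_⟩, hcompat⟩
  · intro x hx y hy
    have e : (⟨((coverIndex C q : ℕ) : ℤ) • (x + y), smul_mem_coverOrder X q (add_mem hx hy)⟩ : coverSubring X q) =
        ⟨((coverIndex C q : ℕ) : ℤ) • x, smul_mem_coverOrder X q hx⟩ + ⟨((coverIndex C q : ℕ) : ℤ) • y, smul_mem_coverOrder X q hy⟩ :=
      Subtype.ext (smul_add _ _ _)
    rw [hψ _ (add_mem hx hy), hψ x hx, hψ y hy, e, map_add, smul_add]
  · intro x hx y hy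
    have hxy : x * y ∈ X.O₀ := hO₀.mul_mem _ hx _ hy
    have e : (⟨((coverIndex C q : ℕ) : ℤ) • x, smul_mem_coverOrder X q hx⟩ : coverSubring X q) *
          ⟨((coverIndex C q : ℕ) : ℤ) • y, smul_mem_coverOrder X q hy⟩ =
        ((coverIndex C q : ℕ) : ℤ) • (⟨((coverIndex C q : ℕ) : ℤ) • (x * y), smul_mem_coverOrder X q hxy⟩ : coverSubring X q) :=
      Subtype.ext (by
        change ((coverIndex C q : ℕ) : ℤ) • x * (((coverIndex C q : ℕ) : ℤ) • y) =
          ((coverIndex C q : ℕ) : ℤ) • (((coverIndex C q : ℕ) : ℤ) • (x * y))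
        rw [smul_mul_assoc, mul_smul_comm])
    rw [hψ _ hxy, hψ x hx, hψ y hy, smul_mul_assoc, mul_smul_comm, smul_smul, ← map_mul, e, map_zsmul, hz, smul_smul,
      inv_mul_cancel_right₀ hc]
  · have e : (⟨((coverIndex C q : ℕ) : ℤ) • (1 : X.B), smul_mem_coverOrder X q hO₀.one_mem⟩ : coverSubring X q) =
        ((coverIndex C q : ℕ) : ℤ) • (1 : coverSubring X q) := rfl
    rw [hψ 1 hO₀.one_mem, e, map_zsmul, map_one, hz, smul_smul, inv_mul_cancel₀ hc, one_smul]
  · intro A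
    obtain ⟨z, hzA⟩ := R.red_surjective A
    exact ⟨z, coverOrder_le X q z.2, by rw [hcompat z z.2]; exact hzA⟩
  · intro x hx
    rw [hψ x hx]
    constructor
    · intro h
      have h' : R.red ⟨((coverIndex C q : ℕ) : ℤ) • x, smul_mem_coverOrder X q hx⟩ = 0 :=
        (smul_eq_zero.mp h).resolve_left (inv_ne_zero hc)
      obtain ⟨y, hy, he⟩ := (R.red_eq_zero_iff _).mp h'
      obtain ⟨a, b, hab⟩ := exists_bezout_of_not_dvd hqP hndvd
      refine ⟨a • y + b • x, add_mem (X.O₀.smul_mem _ (coverOrder_le X q hy)) (X.O₀.smul_mem _ hx), ?_⟩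
      calc x = (a * ((coverIndex C q : ℕ) : ℤ) + b * ((q : ℕ) : ℤ)) • x := by rw [hab, one_smul]
        _ = a • (((coverIndex C q : ℕ) : ℤ) • x) + ((q : ℕ) : ℤ) • (b • x) := by rw [add_smul, mul_smul, mul_comm b, mul_smul]
        _ = ((q : ℕ) : ℤ) • (a • y + b • x) := by
          rw [show ((coverIndex C q : ℕ) : ℤ) • x = ((q : ℕ) : ℤ) • y from he, smul_add, smul_comm a]
    · rintro ⟨y, hy, rfl⟩
      have h' : R.red ⟨((coverIndex C q : ℕ) : ℤ) • (((q : ℕ) : ℤ) • y), smul_mem_coverOrder X q hx⟩ = 0 :=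
        (R.red_eq_zero_iff _).mpr ⟨((coverIndex C q : ℕ) : ℤ) • y, smul_mem_coverOrder X q hy, by
          change ((coverIndex C q : ℕ) : ℤ) • (((q : ℕ) : ℤ) • y) = ((q : ℕ) : ℤ) • (((coverIndex C q : ℕ) : ℤ) • y)
          rw [smul_comm]⟩
      rw [h', smul_zero]

end Cover

end Summit.BirchSwinnertonDyer.BirchSwinnertonDyer.Theorems.CartanTransport.Split
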